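import Mathlib
import HarnessLib
import Literature.Geometry.DiscreteGeometry.BondGraph
import Literature.Geometry.DiscreteGeometry.KissingPatterns
import Literature.Algebra.EuclideanLattices.FccBccLattices
import Summits.AtomisticToContinuum.Crystallization.Theorems.PricedLinkCensusSoftLayerPropagationStubMetricDet
import Summits.AtomisticToContinuum.Crystallization.Theorems.PricedLinkCensusSoftLayerPropagationStubMetricSolve

/-!
# The quadratic solving lemma (crux `SoftLayerPropagation`, line `Sketch`, stub `develop_H1R`)

Route `PricedLinkCensus`, crux `SoftLayerPropagation` (stmt-AtomisticToContinuum-14233), line `Sketch`.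
Helper file for the registered stub `develop_H1R` (metric ordered caps): the `ℓ²` sharpening of the
solving lemma `Theorems.metric_solve` used by the sharp octahedron / cap lemmas of the stub.

* `norm_sq_mul_det3_sq_eq` — the adjugate identity
  `‖v‖² det(n₁,n₂,n₃)² = cᵀ adj(G) c`, `cₖ = ⟪v,nₖ⟫`, `G` the Gram matrix of `n₁,n₂,n₃` (coordinates, `ring`);
* **`solve_sq`** — if `νₖ ≤ ‖nₖ‖`, `|⟪nᵢ,nⱼ⟫| ≤ γ` and `|⟪v,nₖ⟫| ≤ βₖ` then
  `‖v‖² (ν₁²ν₂²ν₃² − (ν₁²+ν₂²+ν₃²)γ² − 2γ³) ≤ β₁²ν₂²ν₃² + β₂²ν₁²ν₃² + β₃²ν₁²ν₂²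
     + 2 (β₁β₂ (γ ν₃² + γ²) + β₁β₃ (γ ν₂² + γ²) + β₂β₃ (γ ν₁² + γ²))`
  (the quadratic form `cᵀ adj(G) c` bounded entrywise, and robust independence
  `Theorems.det3_sq_ge_of_inner_le`); for a nearly orthogonal triple this is the Pythagorean
  `‖v‖² ≲ Σ βₖ²/νₖ²` instead of the `(Σ βₖ/νₖ)²` of `metric_solve`.

All `[folklore]`.
-/

noncomputable section

namespace Summit.AtomisticToContinuum.Crystallization.Theorems

open Literature.Geometry.DiscreteGeometry

/-- **The adjugate identity**: `‖v‖² det(n₁,n₂,n₃)² = Σ cₖ² (‖nₗ‖²‖nₘ‖² − gₗₘ²) + 2 Σ cₖcₗ (gₖₘgₗₘ − gₖₗ‖nₘ‖²)`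
with `cₖ = ⟪v, nₖ⟫`, `gₖₗ = ⟪nₖ, nₗ⟫` (i.e. `‖v‖² det G = cᵀ adj(G) c`). [folklore] -/
theorem norm_sq_mul_det3_sq_eq (v n₁ n₂ n₃ : EuclideanSpace ℝ (Fin 3)) :
    ‖v‖ ^ 2 * Matrix.det ![WithLp.ofLp n₁, WithLp.ofLp n₂, WithLp.ofLp n₃] ^ 2 =
      inner ℝ v n₁ ^ 2 * (‖n₂‖ ^ 2 * ‖n₃‖ ^ 2 - inner ℝ n₂ n₃ ^ 2) +
      inner ℝ v n₂ ^ 2 * (‖n₁‖ ^ 2 * ‖n₃‖ ^ 2 - inner ℝ n₁ n₃ ^ 2) +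
      inner ℝ v n₃ ^ 2 * (‖n₁‖ ^ 2 * ‖n₂‖ ^ 2 - inner ℝ n₁ n₂ ^ 2) +
      2 * (inner ℝ v n₁ * inner ℝ v n₂) * (inner ℝ n₁ n₃ * inner ℝ n₂ n₃ - inner ℝ n₁ n₂ * ‖n₃‖ ^ 2) +
      2 * (inner ℝ v n₁ * inner ℝ v n₃) * (inner ℝ n₁ n₂ * inner ℝ n₂ n₃ - inner ℝ n₁ n₃ * ‖n₂‖ ^ 2) +
      2 * (inner ℝ v n₂ * inner ℝ v n₃) * (inner ℝ n₁ n₂ * inner ℝ n₁ n₃ - inner ℝ n₂ n₃ * ‖n₁‖ ^ 2) := by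
  simp only [det3_eq, Literature.Algebra.EuclideanLattices.norm_sq_fin_three,
    Literature.Algebra.EuclideanLattices.inner_fin_three]
  ring

/-- Entrywise bound for the quadratic form `cᵀ adj(G) c`. [folklore] -/
theorem adj_form_le {c₁ c₂ c₃ g₁₂ g₁₃ g₂₃ a₁ a₂ a₃ β₁ β₂ β₃ γ : ℝ}
    (hβ₁ : 0 ≤ β₁) (hβ₂ : 0 ≤ β₂) (hβ₃ : 0 ≤ β₃) (hγ : 0 ≤ γ)
    (ha₁ : 0 ≤ a₁) (ha₂ : 0 ≤ a₂) (ha₃ : 0 ≤ a₃)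
    (hc₁ : |c₁| ≤ β₁) (hc₂ : |c₂| ≤ β₂) (hc₃ : |c₃| ≤ β₃)
    (h₁₂ : |g₁₂| ≤ γ) (h₁₃ : |g₁₃| ≤ γ) (h₂₃ : |g₂₃| ≤ γ) :
    c₁ ^ 2 * (a₂ * a₃ - g₂₃ ^ 2) + c₂ ^ 2 * (a₁ * a₃ - g₁₃ ^ 2) + c₃ ^ 2 * (a₁ * a₂ - g₁₂ ^ 2) +
      2 * (c₁ * c₂) * (g₁₃ * g₂₃ - g₁₂ * a₃) + 2 * (c₁ * c₃) * (g₁₂ * g₂₃ - g₁₃ * a₂) +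
      2 * (c₂ * c₃) * (g₁₂ * g₁₃ - g₂₃ * a₁) ≤
    β₁ ^ 2 * (a₂ * a₃) + β₂ ^ 2 * (a₁ * a₃) + β₃ ^ 2 * (a₁ * a₂) +
      2 * (β₁ * β₂ * (γ * a₃ + γ ^ 2) + β₁ * β₃ * (γ * a₂ + γ ^ 2) + β₂ * β₃ * (γ * a₁ + γ ^ 2)) := by
  have s₁ : c₁ ^ 2 ≤ β₁ ^ 2 := sq_le_sq' (abs_le.1 hc₁).1 (abs_le.1 hc₁).2
  have s₂ : c₂ ^ 2 ≤ β₂ ^ 2 := sq_le_sq' (abs_le.1 hc₂).1 (abs_le.1 hc₂).2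
  have s₃ : c₃ ^ 2 ≤ β₃ ^ 2 := sq_le_sq' (abs_le.1 hc₃).1 (abs_le.1 hc₃).2
  -- the diagonal terms
  have d₁ : c₁ ^ 2 * (a₂ * a₃ - g₂₃ ^ 2) ≤ β₁ ^ 2 * (a₂ * a₃) := by
    nlinarith [mul_le_mul_of_nonneg_right s₁ (mul_nonneg ha₂ ha₃), mul_nonneg (sq_nonneg c₁) (sq_nonneg g₂₃)]
  have d₂ : c₂ ^ 2 * (a₁ * a₃ - g₁₃ ^ 2) ≤ β₂ ^ 2 * (a₁ * a₃) := by
    nlinarith [mul_le_mul_of_nonneg_right s₂ (mul_nonneg ha₁ ha₃), mul_nonneg (sq_nonneg c₂) (sq_nonneg g₁₃)]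
  have d₃ : c₃ ^ 2 * (a₁ * a₂ - g₁₂ ^ 2) ≤ β₃ ^ 2 * (a₁ * a₂) := by
    nlinarith [mul_le_mul_of_nonneg_right s₃ (mul_nonneg ha₁ ha₂), mul_nonneg (sq_nonneg c₃) (sq_nonneg g₁₂)]
  -- the off-diagonal terms: `|cₖ cₗ (gₖₘ gₗₘ − gₖₗ aₘ)| ≤ βₖ βₗ (γ² + γ aₘ)`
  have key : ∀ {x y p q a βx βy : ℝ}, 0 ≤ βx → 0 ≤ βy → 0 ≤ a → |x| ≤ βx → |y| ≤ βy →
      |p| ≤ γ → |q| ≤ γ → ∀ {r : ℝ}, |r| ≤ γ →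
      2 * (x * y) * (p * q - r * a) ≤ 2 * (βx * βy * (γ * a + γ ^ 2)) := by
    intro x y p q a βx βy hx0 hy0 ha hx hy hp hq r hr
    have hxy : |x * y| ≤ βx * βy := by rw [abs_mul]; exact mul_le_mul hx hy (abs_nonneg _) hx0
    have hpq : |p * q| ≤ γ * γ := by rw [abs_mul]; exact mul_le_mul hp hq (abs_nonneg _) hγ
    have hra : |r * a| ≤ γ * a := by rw [abs_mul, abs_of_nonneg ha]; exact mul_le_mul_of_nonneg_right hr ha
    have h1 : |p * q - r * a| ≤ γ * a + γ ^ 2 := by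
      calc |p * q - r * a| ≤ |p * q| + |r * a| := abs_sub _ _
        _ ≤ γ * γ + γ * a := add_le_add hpq hra
        _ = γ * a + γ ^ 2 := by ring
    have h2 : |x * y * (p * q - r * a)| ≤ βx * βy * (γ * a + γ ^ 2) := by
      rw [abs_mul]; exact mul_le_mul hxy h1 (abs_nonneg _) (mul_nonneg hx0 hy0)
    have h3 := (abs_le.1 h2).2
    linarith
  have o₁₂ := key hβ₁ hβ₂ ha₃ hc₁ hc₂ h₁₃ h₂₃ h₁₂
  have o₁₃ := key hβ₁ hβ₃ ha₂ hc₁ hc₃ h₁₂ h₂₃ h₁₃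
  have o₂₃ := key hβ₂ hβ₃ ha₁ hc₂ hc₃ h₁₂ h₁₃ h₂₃
  linarith

/-- **The quadratic solving lemma (`solve_sq`).**  If `νₖ ≤ ‖nₖ‖` (`νₖ > 0`), `|⟪nᵢ, nⱼ⟫| ≤ γ` and
`|⟪v, nₖ⟫| ≤ βₖ`, then
`‖v‖² (ν₁²ν₂²ν₃² − (ν₁²+ν₂²+ν₃²) γ² − 2γ³) ≤ β₁²ν₂²ν₃² + β₂²ν₁²ν₃² + β₃²ν₁²ν₂²
  + 2 (β₁β₂ (γν₃² + γ²) + β₁β₃ (γν₂² + γ²) + β₂β₃ (γν₁² + γ²))`.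
Proof: `‖v‖² det² = cᵀ adj(G) c ≤ P² (Σ βₖ²/‖nₖ‖² + …)` with `P = ‖n₁‖‖n₂‖‖n₃‖`, robust independence
`det² ≥ P² − (Σ‖nₖ‖²)γ² − 2γ³`, and the monotonicity in the `‖nₖ‖` that lets the `P`'s cancel. [folklore] -/
theorem solve_sq : ∀ {ν₁ ν₂ ν₃ γ β₁ β₂ β₃ : ℝ}, 0 < ν₁ → 0 < ν₂ → 0 < ν₃ → 0 ≤ γ → 0 ≤ β₁ → 0 ≤ β₂ → 0 ≤ β₃ → ∀ (v n₁ n₂ n₃ : EuclideanSpace ℝ (Fin 3)), ν₁ ≤ ‖n₁‖ → ν₂ ≤ ‖n₂‖ → ν₃ ≤ ‖n₃‖ → |inner ℝ n₁ n₂| ≤ γ → |inner ℝ n₁ n₃| ≤ γ → |inner ℝ n₂ n₃| ≤ γ → |inner ℝ v n₁| ≤ β₁ → |inner ℝ v n₂| ≤ β₂ → |inner ℝ v n₃| ≤ β₃ → ‖v‖ ^ 2 * (ν₁ ^ 2 * ν₂ ^ 2 * ν₃ ^ 2 - (ν₁ ^ 2 + ν₂ ^ 2 + ν₃ ^ 2)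 * γ ^ 2 - 2 * γ ^ 3) ≤ β₁ ^ 2 * ν₂ ^ 2 * ν₃ ^ 2 + β₂ ^ 2 * ν₁ ^ 2 * ν₃ ^ 2 + β₃ ^ 2 * ν₁ ^ 2 * ν₂ ^ 2 + 2 * (β₁ * β₂ * (γ * ν₃ ^ 2 + γ ^ 2) + β₁ * β₃ * (γ * ν₂ ^ 2 + γ ^ 2) + β₂ * β₃ * (γ * ν₁ ^ 2 + γ ^ 2)) := by
  intro ν₁ ν₂ ν₃ γ β₁ β₂ β₃ hν₁ hν₂ hν₃ hγ hβ₁ hβ₂ hβ₃ v n₁ n₂ n₃ hn₁ hn₂ hn₃ h₁₂ h₁₃ h₂₃ hv₁ hv₂ hv₃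
  set a₁ := ‖n₁‖ ^ 2 with ha₁
  set a₂ := ‖n₂‖ ^ 2 with ha₂
  set a₃ := ‖n₃‖ ^ 2 with ha₃
  set T2 := Matrix.det ![WithLp.ofLp n₁, WithLp.ofLp n₂, WithLp.ofLp n₃] ^ 2 with hT2
  have q₁ : ν₁ ^ 2 ≤ a₁ := pow_le_pow_left₀ hν₁.le hn₁ 2
  have q₂ : ν₂ ^ 2 ≤ a₂ := pow_le_pow_left₀ hν₂.le hn₂ 2
  have q₃ : ν₃ ^ 2 ≤ a₃ := pow_le_pow_left₀ hν₃.le hn₃ 2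
  have p₁ : 0 < ν₁ ^ 2 := by positivity
  have p₂ : 0 < ν₂ ^ 2 := by positivity
  have p₃ : 0 < ν₃ ^ 2 := by positivity
  have a₁p : 0 < a₁ := p₁.trans_le q₁
  have a₂p : 0 < a₂ := p₂.trans_le q₂
  have a₃p : 0 < a₃ := p₃.trans_le q₃
  -- (1) `‖v‖² T² ≤ R(a)` with `R(a) = Σ βₖ² aₗ aₘ + 2 Σ βₖβₗ (γ aₘ + γ²)`
  have h1 : ‖v‖ ^ 2 * T2 ≤ β₁ ^ 2 * (a₂ * a₃) + β₂ ^ 2 * (a₁ * a₃) + β₃ ^ 2 * (a₁ * a₂) +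
      2 * (β₁ * β₂ * (γ * a₃ + γ ^ 2) + β₁ * β₃ * (γ * a₂ + γ ^ 2) + β₂ * β₃ * (γ * a₁ + γ ^ 2)) := by
    rw [hT2, norm_sq_mul_det3_sq_eq]
    exact adj_form_le hβ₁ hβ₂ hβ₃ hγ a₁p.le a₂p.le a₃p.le hv₁ hv₂ hv₃ h₁₂ h₁₃ h₂₃
  -- (2) robust independence: `T² ≥ a₁a₂a₃ − (a₁+a₂+a₃)γ² − 2γ³`
  have h2 : a₁ * a₂ * a₃ - (a₁ + a₂ + a₃) * γ ^ 2 - 2 * γ ^ 3 ≤ T2 := by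
    have key := det3_sq_ge_of_inner_le hγ n₁ n₂ n₃ h₁₂ h₁₃ h₂₃
    rw [← ha₁, ← ha₂, ← ha₃] at key
    linear_combination key
  -- (3) the monotonicity facts in the `aₖ`
  set P := a₁ * a₂ * a₃ with hP
  have hPp : 0 < P := by positivity
  have e1 : ν₁ ^ 2 * (a₂ * a₃) ≤ P := by
    rw [hP]; calc ν₁ ^ 2 * (a₂ * a₃) = ν₁ ^ 2 * a₂ * a₃ := by ring
      _ ≤ a₁ * a₂ * a₃ := by gcongr
  have e2 : ν₂ ^ 2 * (a₁ * a₃) ≤ P := by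
    rw [hP]; calc ν₂ ^ 2 * (a₁ * a₃) = a₁ * ν₂ ^ 2 * a₃ := by ring
      _ ≤ a₁ * a₂ * a₃ := by gcongr
  have e3 : ν₃ ^ 2 * (a₁ * a₂) ≤ P := by
    rw [hP]; calc ν₃ ^ 2 * (a₁ * a₂) = a₁ * a₂ * ν₃ ^ 2 := by ring
      _ ≤ a₁ * a₂ * a₃ := by gcongr
  have k1 : ν₁ ^ 2 * ν₂ ^ 2 * ν₃ ^ 2 * a₁ ≤ ν₁ ^ 2 * P := by
    rw [hP]; calc ν₁ ^ 2 * ν₂ ^ 2 * ν₃ ^ 2 * a₁ = ν₁ ^ 2 * (a₁ * ν₂ ^ 2 * ν₃ ^ 2) := by ring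
      _ ≤ ν₁ ^ 2 * (a₁ * a₂ * a₃) := by gcongr
  have k2 : ν₁ ^ 2 * ν₂ ^ 2 * ν₃ ^ 2 * a₂ ≤ ν₂ ^ 2 * P := by
    rw [hP]; calc ν₁ ^ 2 * ν₂ ^ 2 * ν₃ ^ 2 * a₂ = ν₂ ^ 2 * (ν₁ ^ 2 * a₂ * ν₃ ^ 2) := by ring
      _ ≤ ν₂ ^ 2 * (a₁ * a₂ * a₃) := by gcongr
  have k3 : ν₁ ^ 2 * ν₂ ^ 2 * ν₃ ^ 2 * a₃ ≤ ν₃ ^ 2 * P := by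
    rw [hP]; calc ν₁ ^ 2 * ν₂ ^ 2 * ν₃ ^ 2 * a₃ = ν₃ ^ 2 * (ν₁ ^ 2 * ν₂ ^ 2 * a₃) := by ring
      _ ≤ ν₃ ^ 2 * (a₁ * a₂ * a₃) := by gcongr
  have e7 : ν₁ ^ 2 * ν₂ ^ 2 * ν₃ ^ 2 ≤ P := by rw [hP]; gcongr
  -- (4) `μ R(a) ≤ P R(ν)` with `μ = ν₁²ν₂²ν₃²`
  have h3 : ν₁ ^ 2 * ν₂ ^ 2 * ν₃ ^ 2 * (β₁ ^ 2 * (a₂ * a₃) + β₂ ^ 2 * (a₁ * a₃) + β₃ ^ 2 * (a₁ * a₂) +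
      2 * (β₁ * β₂ * (γ * a₃ + γ ^ 2) + β₁ * β₃ * (γ * a₂ + γ ^ 2) + β₂ * β₃ * (γ * a₁ + γ ^ 2))) ≤
      P * (β₁ ^ 2 * ν₂ ^ 2 * ν₃ ^ 2 + β₂ ^ 2 * ν₁ ^ 2 * ν₃ ^ 2 + β₃ ^ 2 * ν₁ ^ 2 * ν₂ ^ 2 +
      2 * (β₁ * β₂ * (γ * ν₃ ^ 2 + γ ^ 2) + β₁ * β₃ * (γ * ν₂ ^ 2 + γ ^ 2) +
        β₂ * β₃ * (γ * ν₁ ^ 2 + γ ^ 2))) := by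
    have f1 := mul_le_mul_of_nonneg_left e1 (show 0 ≤ β₁ ^ 2 * ν₂ ^ 2 * ν₃ ^ 2 by positivity)
    have f2 := mul_le_mul_of_nonneg_left e2 (show 0 ≤ β₂ ^ 2 * ν₁ ^ 2 * ν₃ ^ 2 by positivity)
    have f3 := mul_le_mul_of_nonneg_left e3 (show 0 ≤ β₃ ^ 2 * ν₁ ^ 2 * ν₂ ^ 2 by positivity)
    have f4 := mul_le_mul_of_nonneg_left k3 (show 0 ≤ 2 * β₁ * β₂ * γ by positivity)
    have f5 := mul_le_mul_of_nonneg_left k2 (show 0 ≤ 2 * β₁ * β₃ * γ by positivity)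
    have f6 := mul_le_mul_of_nonneg_left k1 (show 0 ≤ 2 * β₂ * β₃ * γ by positivity)
    have f7 := mul_le_mul_of_nonneg_left e7
      (show 0 ≤ 2 * (β₁ * β₂ + β₁ * β₃ + β₂ * β₃) * γ ^ 2 by positivity)
    linear_combination f1 + f2 + f3 + f4 + f5 + f6 + f7
  -- (5) `P (μ − Σνₖ²γ² − 2γ³) ≤ μ T²`
  have h4 : P * (ν₁ ^ 2 * ν₂ ^ 2 * ν₃ ^ 2 - (ν₁ ^ 2 + ν₂ ^ 2 + ν₃ ^ 2) * γ ^ 2 - 2 * γ ^ 3) ≤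
      ν₁ ^ 2 * ν₂ ^ 2 * ν₃ ^ 2 * T2 := by
    have g1 := mul_le_mul_of_nonneg_left h2 (show 0 ≤ ν₁ ^ 2 * ν₂ ^ 2 * ν₃ ^ 2 by positivity)
    have g2 := mul_le_mul_of_nonneg_left (add_le_add (add_le_add k1 k2) k3) (sq_nonneg γ)
    have g3 := mul_le_mul_of_nonneg_left e7 (show 0 ≤ 2 * γ ^ 3 by positivity)
    rw [hP] at g1 g2 g3 ⊢
    linear_combination g1 + g2 + g3
  -- (6) combine and divide by `P > 0`
  have g1 := mul_le_mul_of_nonneg_left h4 (sq_nonneg ‖v‖)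
  have g2 := mul_le_mul_of_nonneg_left h1 (show 0 ≤ ν₁ ^ 2 * ν₂ ^ 2 * ν₃ ^ 2 by positivity)
  have : ‖v‖ ^ 2 * (ν₁ ^ 2 * ν₂ ^ 2 * ν₃ ^ 2 - (ν₁ ^ 2 + ν₂ ^ 2 + ν₃ ^ 2) * γ ^ 2 - 2 * γ ^ 3) * P ≤
      (β₁ ^ 2 * ν₂ ^ 2 * ν₃ ^ 2 + β₂ ^ 2 * ν₁ ^ 2 * ν₃ ^ 2 + β₃ ^ 2 * ν₁ ^ 2 * ν₂ ^ 2 +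
      2 * (β₁ * β₂ * (γ * ν₃ ^ 2 + γ ^ 2) + β₁ * β₃ * (γ * ν₂ ^ 2 + γ ^ 2) +
        β₂ * β₃ * (γ * ν₁ ^ 2 + γ ^ 2))) * P := by
    linear_combination g1 + g2 + h3
  exact le_of_mul_le_mul_right this hPp

end Summit.AtomisticToContinuum.Crystallization.Theorems

end
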